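import Summits.HodgeConjecture.CorCM.Census.CyclicCharacterStrictLinearisation

/-!
# Cyclic characters, XXI: ARC DISTANCES — when is an arc type the unique nearest one?

COR-CM (cell `pub-hodgecm2`), count-neutral kernel combinatorics by the binder seat b09 (gen 42; lane CYCLIC-CHARACTER FIBRE LAW, part XXI), on parts XVII/XX BY
NAME.  Theorems only (no definition, no `decide`, no certificate, no named fact, no `sorry`).
HONEST FRAMING: `HC_CM` is NOT proved, here or anywhere in the tree; nothing here is a period or a headline.

The uniqueness hypothesis of part XX (`single_sub_normalForm_mem_of_toward_of_unique`) is discharged here WITHOUT case analysis on the arc: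
* §1 **three-type inequality** (`ddist_add_two_mul_card_le`, any three CM types): `ddist T' T + 2|D ∩ T'| ≤ ddist T' Ψ + |D|` for `D = T ∖ Ψ` — the points of
  `D` inside `T'` count twice against `T'`.
* §2 **fibres**: a point of `T ∖ T'` (two arc types) carries its whole `ker w`-coset, so `ddist T' T ≥ |ker w|`, and `≥ 2|ker w|` with two points of
  different `w`-value (`card_ker_le_ddist_of_mem`, `two_mul_card_ker_le_ddist_of_mem`).
* §3 **UNIQUENESS** (`rt_arcType_eq_of_sdiff_small`): if `2|T ∖ Ψ| ≤ |ker w| + 1` and, in case `2|T ∖ Ψ| ≥ |ker w|`, the deviation set has two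
  different `w`-values, then `T` is the ONLY arc type realising the potential of `Ψ` — for `T = T_0·Q₀⁻¹` arbitrary.  This covers the equator corners of
  part XIX (`|T ∖ Ψ| ≤ (n ± 1)/2`, two fibres met as soon as a spectator point is flipped) and hence the spectator faces of the general law.
-/

namespace Summit.HodgeConjecture.CorCM.Census.CyclicCharacter

open Finset
open Summit.HodgeConjecture.CorCM.Prior.AllgGroup.RfwfAllgGroup
open Summit.HodgeConjecture.CorCM.Census.BlockParity
open Summit.HodgeConjecture.CorCM.Census.Coinvariant
open Summit.HodgeConjecture.CorCM.Census.TwistGeneration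
open Summit.HodgeConjecture.CorCM.Census.Nondegenerate
open Summit.HodgeConjecture.CorCM.Census.BaseBlock

noncomputable section

variable {G : Type*} [Group G] [Fintype G] [DecidableEq G] {k : ℕ} {w : G → ZMod (2 ^ k)} {c : G}

/-! ## §1 The three-type inequality -/

/-- `Ψ ∖ T = c·(T ∖ Ψ)` for CM types. [folklore] -/
theorem sdiff_eq_image_cmul_sdiff (hc2 : c * c = 1) (T Ψ : CMF G c) : Ψ.1 \ T.1 = (T.1 \ Ψ.1).image fun x => c * x := by
  ext y
  rw [mem_sdiff, mem_image]
  constructor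
  · rintro ⟨hyΨ, hyT⟩
    refine ⟨c * y, mem_sdiff.mpr ⟨?_, (Ψ.2 y).mp hyΨ⟩, by rw [← mul_assoc, hc2, one_mul]⟩
    by_contra h; exact hyT ((T.2 y).mpr h)
  · rintro ⟨x, hx, rfl⟩
    rw [mem_sdiff] at hx
    exact ⟨by by_contra h; exact hx.2 ((Ψ.2 x).mpr h), (T.2 x).mp hx.1⟩

/-- **THE THREE-TYPE INEQUALITY**: `ddist T' T + 2·|(T ∖ Ψ) ∩ T'| ≤ ddist T' Ψ + |T ∖ Ψ|` for any CM types `T, T', Ψ`. [folklore] -/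
theorem ddist_add_two_mul_card_le (hc2 : c * c = 1) (T T' Ψ : CMF G c) :
    ddist T' T + 2 * ((T.1 \ Ψ.1) ∩ T'.1).card ≤ ddist T' Ψ + (T.1 \ Ψ.1).card := by
  unfold ddist
  -- `T' ∖ Ψ ⊇ (D ∩ T') ⊔ ((T' ∖ T) ∖ Ψ)`
  have h1 : ((T.1 \ Ψ.1) ∩ T'.1).card + ((T'.1 \ T.1) \ Ψ.1).card ≤ (T'.1 \ Ψ.1).card := by
    rw [← card_union_of_disjoint]
    · exact card_le_card fun x hx => by
        rw [mem_union, mem_inter, mem_sdiff, mem_sdiff, mem_sdiff] at hx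
        rw [mem_sdiff]; tauto
    · rw [Finset.disjoint_left]
      intro x hx hx'
      exact (mem_sdiff.mp (mem_sdiff.mp hx').1).2 (mem_sdiff.mp (mem_inter.mp hx).1).1
  -- `(T' ∖ T) ∩ Ψ ⊆ c·(D ∖ T')`
  have h2 : ((T'.1 \ T.1) ∩ Ψ.1).card ≤ ((T.1 \ Ψ.1) \ T'.1).card := by
    calc ((T'.1 \ T.1) ∩ Ψ.1).card ≤ (((T.1 \ Ψ.1) \ T'.1).image fun x => c * x).card := card_le_card fun x hx => by
            rw [mem_inter, mem_sdiff] at hx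
            rw [mem_image]
            refine ⟨c * x, mem_sdiff.mpr ⟨mem_sdiff.mpr ⟨?_, ?_⟩, (T'.2 x).mp hx.1.1⟩, by rw [← mul_assoc, hc2, one_mul]⟩
            · by_contra h; exact hx.1.2 ((T.2 x).mpr h)
            · exact (Ψ.2 x).mp hx.2
      _ ≤ _ := card_image_le
  have h3 : ((T'.1 \ T.1) \ Ψ.1).card + ((T'.1 \ T.1) ∩ Ψ.1).card = (T'.1 \ T.1).card := by
    rw [← card_union_of_disjoint (disjoint_sdiff_inter _ _), sdiff_union_inter]
  have h4 : ((T.1 \ Ψ.1) \ T'.1).card + ((T.1 \ Ψ.1) ∩ T'.1).card = (T.1 \ Ψ.1).card := by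
    rw [← card_union_of_disjoint (disjoint_sdiff_inter _ _), sdiff_union_inter]
  omega

/-! ## §2 Fibres inside the difference of two arc types -/

/-- The `ker w`-coset of a point of `T_0·Q₀⁻¹ ∖ T_0·Q⁻¹` stays inside. [folklore] -/
theorem mul_mem_sdiff_rt_rt (hw : ∀ P Q : G, w (P * Q) = w P + w Q) (hk : 1 ≤ k) (hc2 : c * c = 1) (hwc : w c ≠ 0) (Q₀ Q : G) {d n : G}
    (hd : d ∈ (rt c Q₀ (arcType hw hk hc2 hwc 0)).1 \ (rt c Q (arcType hw hk hc2 hwc 0)).1) (hn : w n = 0) :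
    d * n ∈ (rt c Q₀ (arcType hw hk hc2 hwc 0)).1 \ (rt c Q (arcType hw hk hc2 hwc 0)).1 := by
  rw [rt_arcType, rt_arcType] at hd ⊢
  rw [mem_sdiff, mem_arcType, mem_arcType, hw, hn, add_zero] at *
  exact hd

/-- **One point of `T ∖ T'` gives `|ker w| ≤ ddist T' T`** (two arc types). [folklore] -/
theorem card_ker_le_ddist_of_mem (hw : ∀ P Q : G, w (P * Q) = w P + w Q) (hk : 1 ≤ k) (hc2 : c * c = 1) (hwc : w c ≠ 0) (Q₀ Q : G) {d : G}
    (hd : d ∈ (rt c Q₀ (arcType hw hk hc2 hwc 0)).1 \ (rt c Q (arcType hw hk hc2 hwc 0)).1) :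
    (univ.filter fun n : G => w n = 0).card ≤ ddist (rt c Q (arcType hw hk hc2 hwc 0)) (rt c Q₀ (arcType hw hk hc2 hwc 0)) := by
  rw [ddist_comm hc2]
  unfold ddist
  calc (univ.filter fun n : G => w n = 0).card = ((univ.filter fun n : G => w n = 0).image fun n => d * n).card :=
        (card_image_of_injective _ (mul_right_injective d)).symm
    _ ≤ _ := card_le_card fun x hx => by
        obtain ⟨n, hn, rfl⟩ := mem_image.mp hx
        exact mul_mem_sdiff_rt_rt hw hk hc2 hwc Q₀ Q hd (mem_filter.mp hn).2

/-- **Two points of `T ∖ T'` with different `w`-values give `2|ker w| ≤ ddist T' T`.** [folklore] -/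
theorem two_mul_card_ker_le_ddist_of_mem (hw : ∀ P Q : G, w (P * Q) = w P + w Q) (hk : 1 ≤ k) (hc2 : c * c = 1) (hwc : w c ≠ 0)
    (Q₀ Q : G) {d₁ d₂ : G} (hd₁ : d₁ ∈ (rt c Q₀ (arcType hw hk hc2 hwc 0)).1 \ (rt c Q (arcType hw hk hc2 hwc 0)).1)
    (hd₂ : d₂ ∈ (rt c Q₀ (arcType hw hk hc2 hwc 0)).1 \ (rt c Q (arcType hw hk hc2 hwc 0)).1) (hw12 : w d₁ ≠ w d₂) :
    2 * (univ.filter fun n : G => w n = 0).card ≤ ddist (rt c Q (arcType hw hk hc2 hwc 0)) (rt c Q₀ (arcType hw hk hc2 hwc 0)) := by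
  rw [ddist_comm hc2]
  unfold ddist
  have hdisj : Disjoint ((univ.filter fun n : G => w n = 0).image fun n => d₁ * n) ((univ.filter fun n : G => w n = 0).image fun n => d₂ * n) := by
    rw [Finset.disjoint_left]
    intro x hx₁ hx₂
    obtain ⟨n₁, hn₁, rfl⟩ := mem_image.mp hx₁
    obtain ⟨n₂, hn₂, h⟩ := mem_image.mp hx₂
    apply hw12
    have := congrArg w h
    rw [hw, hw, (mem_filter.mp hn₁).2, (mem_filter.mp hn₂).2] at this
    simpa using this.symm
  calc 2 * (univ.filter fun n : G => w n = 0).card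
      = ((univ.filter fun n : G => w n = 0).image fun n => d₁ * n).card + ((univ.filter fun n : G => w n = 0).image fun n => d₂ * n).card := by
        rw [card_image_of_injective _ (mul_right_injective d₁), card_image_of_injective _ (mul_right_injective d₂)]; ring
    _ = (((univ.filter fun n : G => w n = 0).image fun n => d₁ * n) ∪ ((univ.filter fun n : G => w n = 0).image fun n => d₂ * n)).card :=
        (card_union_of_disjoint hdisj).symm
    _ ≤ _ := card_le_card fun x hx => by
        rcases mem_union.mp hx with hx | hx
        · obtain ⟨n, hn, rfl⟩ := mem_image.mp hx
          exact mul_mem_sdiff_rt_rt hw hk hc2 hwc Q₀ Q hd₁ (mem_filter.mp hn).2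
        · obtain ⟨n, hn, rfl⟩ := mem_image.mp hx
          exact mul_mem_sdiff_rt_rt hw hk hc2 hwc Q₀ Q hd₂ (mem_filter.mp hn).2

/-! ## §3 Uniqueness of the nearest arc type -/

/-- **UNIQUENESS OF THE NEAREST ARC TYPE, small-deviation form.**  Let `T = T_0·Q₀⁻¹` and `D = T ∖ Ψ` with `2|D| ≤ |ker w| + 1`, and suppose that
`D` contains two points of different `w`-value whenever `2|D| ≥ |ker w|`.  Then every arc type realising the potential of `Ψ` is `T`. [folklore] -/
theorem rt_arcType_eq_of_sdiff_small (hw : ∀ P Q : G, w (P * Q) = w P + w Q) (hk : 1 ≤ k) (hc2 : c * c = 1) (hwc : w c ≠ 0) {Q₀ Q : G}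
    {Ψ : CMF G c} (hD1 : 2 * ((rt c Q₀ (arcType hw hk hc2 hwc 0)).1 \ Ψ.1).card ≤ (univ.filter fun n : G => w n = 0).card + 1)
    (hD2 : (univ.filter fun n : G => w n = 0).card ≤ 2 * ((rt c Q₀ (arcType hw hk hc2 hwc 0)).1 \ Ψ.1).card →
      ∃ d₁ ∈ (rt c Q₀ (arcType hw hk hc2 hwc 0)).1 \ Ψ.1, ∃ d₂ ∈ (rt c Q₀ (arcType hw hk hc2 hwc 0)).1 \ Ψ.1, w d₁ ≠ w d₂)
    (hn : 2 ≤ (univ.filter fun n : G => w n = 0).card)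
    (hQ : bpot c (arcType hw hk hc2 hwc 0) Ψ = ddist (rt c Q (arcType hw hk hc2 hwc 0)) Ψ) :
    rt c Q (arcType hw hk hc2 hwc 0) = rt c Q₀ (arcType hw hk hc2 hwc 0) := by
  set T := rt c Q₀ (arcType hw hk hc2 hwc 0) with hT
  set T' := rt c Q (arcType hw hk hc2 hwc 0) with hT'
  by_contra hne
  have hle : ddist T' Ψ ≤ (T.1 \ Ψ.1).card := by rw [← hQ]; exact bpot_le c _ Ψ Q₀
  have h3 := ddist_add_two_mul_card_le hc2 T T' Ψ
  -- a point of `T ∖ T'`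
  have hne' : (T.1 \ T'.1).Nonempty := by
    rw [nonempty_iff_ne_empty]; intro h; exact hne (eq_of_dev_empty c h)
  by_cases hmeet : ((T.1 \ Ψ.1) ∩ T'.1).Nonempty
  · obtain ⟨d, hd⟩ := hne'
    have hfib : (univ.filter fun n : G => w n = 0).card ≤ ddist T' T := card_ker_le_ddist_of_mem hw hk hc2 hwc Q₀ Q hd
    have h1 : 1 ≤ ((T.1 \ Ψ.1) ∩ T'.1).card := card_pos.mpr hmeet
    omega
  · -- `D ⊆ T ∖ T'`
    rw [not_nonempty_iff_eq_empty] at hmeet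
    have hsub : T.1 \ Ψ.1 ⊆ T.1 \ T'.1 := fun d hd => mem_sdiff.mpr ⟨(mem_sdiff.mp hd).1, fun h =>
      (notMem_empty d) (hmeet ▸ mem_inter.mpr ⟨hd, h⟩)⟩
    by_cases hD : (univ.filter fun n : G => w n = 0).card ≤ 2 * (T.1 \ Ψ.1).card
    · obtain ⟨d₁, hd₁, d₂, hd₂, h12⟩ := hD2 hD
      have hfib : 2 * (univ.filter fun n : G => w n = 0).card ≤ ddist T' T :=
        two_mul_card_ker_le_ddist_of_mem hw hk hc2 hwc Q₀ Q (hsub hd₁) (hsub hd₂) h12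
      omega
    · obtain ⟨d, hd⟩ := hne'
      have hfib : (univ.filter fun n : G => w n = 0).card ≤ ddist T' T := card_ker_le_ddist_of_mem hw hk hc2 hwc Q₀ Q hd
      omega

/-- **The uniqueness hypothesis of part XX, discharged**: under the same smallness of `T ∖ Φ`, every type deviating from `T` inside `T ∖ Φ` has `T` as its
only nearest arc type. [folklore] -/
theorem unique_of_sdiff_small (hw : ∀ P Q : G, w (P * Q) = w P + w Q) (hk : 1 ≤ k) (hc2 : c * c = 1) (hwc : w c ≠ 0) {Q₀ : G} {Φ : CMF G c}
    (hD1 : 2 * ((rt c Q₀ (arcType hw hk hc2 hwc 0)).1 \ Φ.1).card ≤ (univ.filter fun n : G => w n = 0).card + 1)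
    (hD2 : (univ.filter fun n : G => w n = 0).card ≤ 2 * ((rt c Q₀ (arcType hw hk hc2 hwc 0)).1 \ Φ.1).card →
      ∃ d₁ ∈ (rt c Q₀ (arcType hw hk hc2 hwc 0)).1 \ Φ.1, ∃ d₂ ∈ (rt c Q₀ (arcType hw hk hc2 hwc 0)).1 \ Φ.1, w d₁ ≠ w d₂)
    (hn : 2 ≤ (univ.filter fun n : G => w n = 0).card) :
    ∀ Ψ : CMF G c, (rt c Q₀ (arcType hw hk hc2 hwc 0)).1 \ Ψ.1 ⊆ (rt c Q₀ (arcType hw hk hc2 hwc 0)).1 \ Φ.1 →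
      ∀ Q : G, bpot c (arcType hw hk hc2 hwc 0) Ψ = ddist (rt c Q (arcType hw hk hc2 hwc 0)) Ψ →
        rt c Q (arcType hw hk hc2 hwc 0) = rt c Q₀ (arcType hw hk hc2 hwc 0) := by
  intro Ψ hΨ Q hQ
  have hcard := card_le_card hΨ
  by_cases heq : ((rt c Q₀ (arcType hw hk hc2 hwc 0)).1 \ Ψ.1).card = ((rt c Q₀ (arcType hw hk hc2 hwc 0)).1 \ Φ.1).card
  · have hsame := eq_of_subset_of_card_le hΨ (le_of_eq heq.symm)
    refine rt_arcType_eq_of_sdiff_small hw hk hc2 hwc (by omega) (fun h => ?_) hn hQ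
    obtain ⟨d₁, hd₁, d₂, hd₂, h12⟩ := hD2 (by omega)
    exact ⟨d₁, hsame ▸ hd₁, d₂, hsame ▸ hd₂, h12⟩
  · exact rt_arcType_eq_of_sdiff_small hw hk hc2 hwc (by omega) (fun h => by omega) hn hQ

end

end Summit.HodgeConjecture.CorCM.Census.CyclicCharacter
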